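import Literature.NumberTheory.Sieve.IwaniecAlmostPrimesQuadraticProp2
import Literature.NumberTheory.Sieve.IwaniecAlmostPrimesHolds
import HarnessLib

/-!
# Iwaniec (1978) for a general quadratic: Proposition 2 (lower bound) for `𝒜_G`, and the Theorem from the level of distribution alone — PROVED

General-`G` counterpart of `IwaniecAlmostPrimesProp2Lower.lean` and sequel to
`IwaniecAlmostPrimesQuadraticProp2.lean` (H. Iwaniec, *Almost-primes represented by quadratic
polynomials*, Invent. Math. **47** (1978) 171–188, Proposition 2 (p. 185): "A similar result holds
for lower bound, the function `F(s)` being replaced by `f(s)`" [cite: IwaniecInventiones1978,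
Proposition 2]; R. J. Lemke Oliver, *Almost-primes represented by quadratic polynomials*, Acta
Arith. **151** (2012) 241–261, Lemma 5: "This is essentially the same as Proposition 2 in [8], so
we present it without proof" [cite: LemkeOliverActaArith2012, Lemma 5]).  This file PROVES

* `proposition2G_lower_const_of : lemma2_bilinearSieve → proposition1G_corollary a b c →
   proposition2G_lower_const a b c` — the lower half of Proposition 2 for `𝒜_G = {G(n) : n ≤ x}`
  at a constant sieving level `z ≤ Z < x^{1/2}` (the predicate of
  `IwaniecAlmostPrimesQuadraticSection6.lean`, the only form of the lower bound §6 uses), from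
  Iwaniec's bilinear-remainder linear sieve and the level of distribution `x^{16/15}` of `𝒜_G`
  in bilinear form (`proposition1G_corollary`, Iwaniec's Corollary of Proposition 1 for `G`);

and then assembles the chain of the tree for Iwaniec's Theorem for a general `G`:

* `proposition2G_of_lemma2_of_prop1G` — both halves of Proposition 2 for `𝒜_G`;
* `theorem_quadratic_of_lemma2_of_prop1G : lemma2_bilinearSieve →
   (∀ G as in the Theorem, proposition1G_corollary G) → theorem_quadratic`
  (through `theorem_quadratic_of_prop2G`, §6 for general `G`, `IwaniecAlmostPrimesQuadraticSection6.lean`);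
* **`theorem_quadratic_of_prop1G : (∀ G as in the Theorem, proposition1G_corollary G) →
   theorem_quadratic`**, Lemma 2 being PROVED in the tree (`lemma2_bilinearSieve_holds`,
  `IwaniecAlmostPrimesLemma2.lean` = Iwaniec, Acta Arith. **37** (1980), Theorem 1, reached through
  `IwaniecAlmostPrimesHolds.lean`), and the consistency check `proposition1G_corollary_one_zero_one`
  (the hypothesis at `G = X² + 1` is the tree's PROVED `proposition1_corollary_holds`);
* for a single `G`: `card_P2G_lower_of_prop1G`, **`theorem_quadratic_single_of_prop1G`** — the
  `G`-instance of `theorem_quadratic` (both clauses, constant `1/77`) from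
  `proposition1G_corollary G` for this `G` alone; and, unconditionally at `G = X² + 1`,
  Proposition 2 for `𝒜_{X²+1}` in the general-`G` normalisation (`proposition2G_one_zero_one`).

So the named fact `theorem_quadratic` (display (1) with the constant `1/77` for every irreducible
`G = aX² + bX + c`, `a > 0`, `c` odd, and `G(n) = P₂` infinitely often) now rests on exactly one
input: the level of distribution `x^{16/15}` of `𝒜_G` in bilinear form for every such `G` —
Iwaniec's Corollary of Proposition 1 (p. 176), printed for `n² + 1` ("the general case being
similar", p. 172) and PROVED in the tree for `n² + 1` (`proposition1_corollary_holds`); for a general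
`G` Lemke Oliver (Lemma 3, §3) prints a level `x^{1+γ₀−ε}` with `γ₀ = (1 − α₀)/(2(1 + β₀))` in terms
of the exponents of his Lemma 4.  No named fact is introduced.

Proof of the lower bound: that of `proposition2_lower_const_of` verbatim (`ε' = ε/1000`,
`ε₂ = ε/4`, `N = x^{1/15−ε'}`, `M = x^{1−4ε'}/2^{i+1}` on the dyadic class `2^i ≤ q < 2^{i+1}`;
for `Z ≤ (MN)^{1/2}` Lemma 2 (lower bound, `lemma2_multisetAqG`) at the level `Z` with the main
term compared through `main_term_lower_gen`, `densityProd_level_le_gen`; for `Z > (MN)^{1/2}` the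
claimed main term is nonpositive, `main_term_lower_trivial_gen`; remainders of a class through
`abs_remainder_class_leG` and the level of distribution, at most `⌊log₂ x⌋ + 1` classes), with
`ρ, V, Λ₀, S, r` replaced by `rhoG, densityProdG, lambda0G, siftedCountG, remG` and the Mertens
inputs for `ρ_G` PROVED in `IwaniecAlmostPrimesQuadraticMertens.lean` /
`IwaniecAlmostPrimesQuadraticProp2Prep.lean`.

## References

* H. Iwaniec, Invent. Math. 47 (1978) 171–188, Theorem p. 172, Corollary p. 176, Proposition 2
  p. 185 (`IwaniecInventiones1978`).
* H. Iwaniec, Acta Arith. 37 (1980) 307–320, Theorem 1 (`IwaniecActaArith1980b`).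
* R. J. Lemke Oliver, Acta Arith. 151 (2012) 241–261, Theorem 1, Lemmas 3–5
  (`LemkeOliverActaArith2012`).
-/

open Finset Real Polynomial Filter
open scoped Topology

noncomputable section

namespace Literature.NumberTheory.Sieve.Iwaniec1978

variable {a b c : ℤ}

/-! ### Proposition 2 for `𝒜_G`, lower bound at a constant level, from Lemma 2 and the level of distribution -/

set_option maxHeartbeats 800000 in
/-- **Proposition 2 for `𝒜_G` (lower bound, constant sieving level) from Lemma 2 and the level of
distribution of `𝒜_G` — PROVED** (p. 185: "A similar result holds for lower bound, the function
`F(s)` being replaced by `f(s)`"; Lemke Oliver, Lemma 5), conditions (1), (2) of Lemma 2 for `ρ_G`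
and the tail form of Mertens II for `ρ_G` being proved in the tree.  Every `q` with
`Z ≤ (MN)^{1/2}` is sieved by Lemma 2 at the level `Z`; for `Z > (MN)^{1/2}` the main term is
nonpositive and `S(𝒜_q, Z) ≥ 0` is used. [cite: IwaniecInventiones1978, Proposition 2] -/
theorem proposition2G_lower_const_of (ha : 0 < a) (hc : Odd c)
    (hirr : Irreducible (quadPoly a b c)) (h2 : lemma2_bilinearSieve)
    (h1c : proposition1G_corollary a b c) : proposition2G_lower_const a b c := by
  intro F f hFf γ hγ hγ2
  have hΛ0pos := lambda0G_pos ha hc hirr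
  have hVpos := densityProdG_pos ha hc hirr
  -- constants depending on `γ`, `f` and `G`
  obtain ⟨c₀, K, L₂, hc₀, hK1, hL₂1, HL2⟩ := lemma2_multisetAqG h2 ha hc hirr
  obtain ⟨Rγ, hRγ0, hRev⟩ := eventually_sum_rough_rhoG_div_le ha hc hirr hγ (by linarith)
  obtain ⟨Lf, hLip⟩ := hFf.exists_lipschitzOnWith_lower (a := 1 / 10) (b := 16 / (15 * γ) + 2)
    (by norm_num)
  obtain ⟨fmax, hfmax⟩ := hFf.exists_bound_lower (a := 1 / 10) (b := 16 / (15 * γ) + 2)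
    (by norm_num)
  set Cf : ℝ := Lf / γ + fmax with hCf
  set C₄ : ℝ := 1 / γ + 33 with hC₄
  have hfmax0 : 0 ≤ fmax := by
    have h2mem : (2 : ℝ) ∈ Set.Icc (1 / 10 : ℝ) (16 / (15 * γ) + 2) :=
      ⟨by norm_num, by linarith [show (0 : ℝ) < 16 / (15 * γ) by positivity]⟩
    exact (abs_nonneg _).trans (hfmax 2 h2mem)
  have hCf0 : 0 ≤ Cf := by positivity
  have hC₄0 : 0 < C₄ := by positivity
  refine ⟨(Cf + c₀ * C₄) * Rγ + 1, fun ε hε => ?_⟩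
  -- the case `ε ≥ 1` is vacuous (no `q` with `1 ≤ q < x^{1−ε} ≤ 1`)
  rcases le_or_gt 1 ε with hε1 | hε1
  · refine ⟨1, fun x hx Z cq hZ hcq => ?_⟩
    dsimp only
    have hempty : Finset.Ico 1 ⌈x ^ (1 - ε)⌉₊ = ∅ := by
      have h1 : x ^ (1 - ε) ≤ 1 := Real.rpow_le_one_of_one_le_of_nonpos hx (by linarith)
      have h2 : ⌈x ^ (1 - ε)⌉₊ ≤ 1 := by
        have := Nat.ceil_le_ceil h1
        rwa [Nat.ceil_one] at this
      exact Finset.Ico_eq_empty_of_le h2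
    rw [hempty, Finset.filter_empty, Finset.sum_empty, Finset.sum_empty, zero_sub]
    have hVx : 0 ≤ densityProdG a b c (x ^ γ) * x := mul_nonneg (hVpos _).le (by linarith)
    have hC : 0 ≤ ((Cf + c₀ * C₄) * Rγ + 1) * ε := by positivity
    rw [mul_neg]
    linarith [mul_nonneg hVx hC]
  -- main case `0 < ε < 1`: parameters
  set ε' : ℝ := ε / 1000 with hε'
  set ε₂ : ℝ := ε / 4 with hε₂
  have hε'0 : 0 < ε' := by positivity
  have hε'ε : ε' ≤ ε / 1000 := le_rfl
  have hε₂0 : 0 < ε₂ := by positivity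
  have hε₂3 : ε₂ < 1 / 3 := by rw [hε₂]; linarith
  obtain ⟨C₁, hC₁⟩ := h1c ε' hε'0
  have hC₁0 : 0 ≤ C₁ := prop1G_corollary_const_nonneg hC₁
  set Nx : ℝ → ℝ := fun x => max (x ^ (1 / 15 - ε')) 2 with hNx
  set Mi : ℝ → ℕ → ℝ := fun x i => max (x ^ (1 - 4 * ε') / 2 ^ (i + 1)) 2 with hMi
  have hNx1 : ∀ x, 1 < Nx x := fun x => lt_of_lt_of_le one_lt_two (le_max_right _ _)
  have hMi1 : ∀ x i, 1 < Mi x i := fun x i => lt_of_lt_of_le one_lt_two (le_max_right _ _)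
  -- Lemma 2's coefficients for every `(x, i)`
  choose Lc _au _bu al bl hLc _hau _hbu hal hbl Hq using
    fun (x : ℝ) (i : ℕ) => HL2 F f hFf ε₂ (Mi x i) (Nx x) hε₂0 hε₂3 (hMi1 x i) (hNx1 x)
  set Lmax : ℝ := Real.exp (8 * ε₂⁻¹ ^ 3) with hLmax
  have hLmax0 : 0 ≤ Lmax := (Real.exp_pos _).le
  set B : ℝ := ε₂⁻¹ ^ 8 * Real.exp (K + L₂) with hB
  have hB0 : 0 ≤ B := by positivity
  -- largeness conditions on `x`
  have hγ33 : 0 < min γ (1 / 33) := lt_min hγ (by norm_num)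
  have EV : ∀ᶠ x : ℝ in atTop,
      2 ≤ x ∧ (2 : ℝ) ≤ x ^ γ ∧ (2 : ℝ) ≤ x ^ (1 / 15 - ε') ∧ (4 : ℝ) ≤ x ^ (ε - 4 * ε') ∧
      Real.log 2 ≤ ε' * Real.log x ∧
      (∀ t : ℝ, x ^ (min γ (1 / 33)) ≤ t →
        |densityProdG a b c t * Real.log t - lambda0G a b c| ≤ ε / 8 * lambda0G a b c) ∧
      (∀ T : ℝ, 0 < T → Real.log x / 16 ≤ Real.log T →
        B * Real.log T ^ (-(1 / 3 : ℝ)) ≤ 3 * ε / 4) ∧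
      (∀ T : Finset ℕ, (∀ q ∈ T, 1 ≤ q ∧ (q : ℝ) < x ∧ q.Coprime (primesProdBelow (x ^ γ))) →
        ∑ q ∈ T, (rhoG a b c q : ℝ) / q ≤ Rγ) ∧
      ((⌊Real.logb 2 x⌋₊ : ℝ) + 1) ^ 2 * (Lmax * C₁) * x ^ (1 - ε') ≤
        (ε * (7 / 8 * lambda0G a b c) / γ) * x / Real.log x := by
    have e1 := eventually_ge_atTop (2 : ℝ)
    have e2 := (tendsto_rpow_atTop hγ).eventually_ge_atTop (2 : ℝ)
    have e3 := (tendsto_rpow_atTop (show 0 < 1 / 15 - ε' by rw [hε']; linarith)).eventually_ge_atTop (2 : ℝ)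
    have e4 := (tendsto_rpow_atTop (show 0 < ε - 4 * ε' by rw [hε']; linarith)).eventually_ge_atTop (4 : ℝ)
    have e5 : ∀ᶠ x : ℝ in atTop, Real.log 2 ≤ ε' * Real.log x :=
      (Real.tendsto_log_atTop.const_mul_atTop hε'0).eventually_ge_atTop _
    have e7 := eventually_forall_abs_densityProdG_mul_log_sub_le ha hc hirr
      (show 0 < ε / 8 * lambda0G a b c by positivity) hγ33
    have e8 := eventually_E_small hB0 (show 0 < 3 * ε / 4 by positivity)
    have e9 := hRev
    have e10 := eventually_classes_remainder_le (A := Lmax * C₁) (by positivity)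
      (show 0 < ε * (7 / 8 * lambda0G a b c) / γ by positivity) hε'0
    filter_upwards [e1, e2, e3, e4, e5, e7, e8, e9, e10] with x h1 h2 h3 h4 h5 h7 h8 h9 h10
    exact ⟨h1, h2, h3, h4, h5, h7, h8, h9, h10⟩
  obtain ⟨x₀, hx₀⟩ := Filter.eventually_atTop.mp EV
  refine ⟨x₀, fun x hx Z cq hZ hcq => ?_⟩
  obtain ⟨hx2, hxγ, hxN, hx4, hlog2, hΛ, hE, hR, hrem⟩ := hx₀ x hx
  dsimp only
  set Q := (Finset.Ico 1 ⌈x ^ (1 - ε)⌉₊).filter fun q : ℕ => q.Coprime (primesProdBelow Z)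
    with hQ
  -- basic facts about `x`
  have hx1 : 1 < x := by linarith
  have hx0 : 0 < x := by linarith
  set L := Real.log x with hL
  have hL0 : 0 < L := Real.log_pos hx1
  set z := x ^ γ with hz
  have hz0 : 0 < z := Real.rpow_pos_of_pos hx0 γ
  have hlz : Real.log z = γ * L := Real.log_rpow hx0 γ
  set N := x ^ (1 / 15 - ε') with hN
  have hNx_eq : Nx x = N := max_eq_left hxN
  set D := x ^ (1 - 4 * ε') with hD
  have hD0 : 0 < D := Real.rpow_pos_of_pos hx0 _
  have hxε : x ^ (1 - ε) < x := by
    conv_rhs => rw [← Real.rpow_one x]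
    exact Real.rpow_lt_rpow_of_exponent_lt hx1 (by linarith)
  have hxa : x ^ (min γ (1 / 33)) ≤ z :=
    Real.rpow_le_rpow_of_exponent_le hx1.le (min_le_left _ _)
  -- the level `Z`
  have hZ2 : 2 ≤ Z := hxγ.trans hZ.1
  have hlZ0 : 0 < Real.log Z := Real.log_pos (by linarith)
  -- `Λ` at `z` and at `Z`
  have hΛz := hΛ z hxa
  have hΛZ := hΛ Z (hxa.trans hZ.1)
  set Λz := densityProdG a b c z * Real.log z with hΛz_def
  have hΛz_lo : 7 / 8 * lambda0G a b c ≤ Λz := by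
    have := (abs_le.mp hΛz).1
    have hε8 : ε / 8 * lambda0G a b c ≤ 1 / 8 * lambda0G a b c :=
      mul_le_mul_of_nonneg_right (by linarith) hΛ0pos.le
    linarith
  have hΛz0 : 0 ≤ Λz := by linarith [hΛz_lo, hΛ0pos]
  have hΛzZ0 : 0 ≤ Λz / Real.log Z := div_nonneg hΛz0 hlZ0.le
  have hVz : densityProdG a b c z = Λz / Real.log z := by
    rw [hΛz_def, hlz]; field_simp
  -- membership facts for `q ∈ Q`
  have hQmem : ∀ q ∈ Q, 1 ≤ q ∧ (q : ℝ) < x ^ (1 - ε) ∧ q.Coprime (primesProdBelow Z) := by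
    intro q hq
    rw [hQ, Finset.mem_filter, Finset.mem_Ico] at hq
    exact ⟨hq.1.1, Nat.lt_ceil.mp hq.1.2, hq.2⟩
  -- per-`q` data: the dyadic class
  set iq : ℕ → ℕ := fun q => Nat.log 2 q with hiq
  -- (d1) dyadic range of `q`
  have hd1 : ∀ q ∈ Q, (2 : ℝ) ^ iq q ≤ q ∧ (q : ℝ) < 2 * 2 ^ iq q := by
    intro q hq
    have hq1 := (hQmem q hq).1
    constructor
    · have := Nat.pow_log_le_self 2 (by omega : q ≠ 0)
      exact_mod_cast this
    · have := Nat.lt_pow_succ_log_self (by norm_num : 1 < 2) q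
      have h' : (q : ℝ) < ((2 ^ (Nat.log 2 q + 1) : ℕ) : ℝ) := by exact_mod_cast this
      simpa [pow_succ, mul_comm] using h'
  -- (d2) `Mi x (iq q) = D / 2^{iq+1}` and `q · M ≤ D`
  have hd2 : ∀ q ∈ Q, Mi x (iq q) = D / 2 ^ (iq q + 1) ∧ (q : ℝ) * Mi x (iq q) ≤ D := by
    intro q hq
    obtain ⟨hq1, hqx, -⟩ := hQmem q hq
    obtain ⟨hlo, hhi⟩ := hd1 q hq
    have hq0 : (0 : ℝ) < q := by exact_mod_cast hq1
    have hpow : (0 : ℝ) < 2 ^ (iq q + 1) := by positivity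
    -- `D / 2^{iq+1} ≥ 2`
    have hge2 : (2 : ℝ) ≤ D / 2 ^ (iq q + 1) := by
      rw [le_div_iff₀ hpow]
      have h1 : (2 : ℝ) ^ (iq q + 1) ≤ 2 * q := by rw [pow_succ]; linarith
      have h2 : 2 * (q : ℝ) * 4 ≤ 2 * x ^ (1 - ε) * x ^ (ε - 4 * ε') := by
        have := mul_le_mul hqx.le hx4 (by norm_num) (by positivity)
        linarith
      have h3 : x ^ (1 - ε) * x ^ (ε - 4 * ε') = D := by
        rw [hD, ← Real.rpow_add hx0]; ring_nf
      have h2' : 2 * (q : ℝ) * 4 ≤ 2 * D := by rw [← h3]; linarith [h2]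
      linarith
    have hM : Mi x (iq q) = D / 2 ^ (iq q + 1) := max_eq_left hge2
    refine ⟨hM, ?_⟩
    rw [hM]
    rw [mul_div_assoc', div_le_iff₀ hpow, pow_succ]
    have h5 := mul_le_mul_of_nonneg_right hhi.le hD0.le
    have e5 : 2 * (2 : ℝ) ^ iq q * D = D * (2 ^ iq q * 2) := by ring
    linarith
  -- (d4) the size of `log(M N)` against `log(y/q)`
  have hd4 : ∀ q ∈ Q, 0 < Mi x (iq q) * Nx x ∧
      Real.log (x ^ (16 / 15 : ℝ) / q) - 6 * ε' * L ≤ Real.log (Mi x (iq q) * Nx x) ∧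
      Real.log (Mi x (iq q) * Nx x) ≤ Real.log (x ^ (16 / 15 : ℝ) / q) ∧
      L / 16 ≤ Real.log (Mi x (iq q) * Nx x) := by
    intro q hq
    obtain ⟨hq1, hqx, -⟩ := hQmem q hq
    obtain ⟨hlo, hhi⟩ := hd1 q hq
    obtain ⟨hM, -⟩ := hd2 q hq
    have hq0 : (0 : ℝ) < q := by exact_mod_cast hq1
    have hpow : (0 : ℝ) < 2 ^ (iq q + 1) := by positivity
    have hMN0 : 0 < Mi x (iq q) * Nx x := mul_pos (by linarith [hMi1 x (iq q)]) (by linarith [hNx1 x])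
    refine ⟨hMN0, ?_⟩
    rw [hM, hNx_eq, Real.log_mul (by positivity) (by positivity), Real.log_div hD0.ne' hpow.ne',
      hD, hN, Real.log_rpow hx0, Real.log_rpow hx0, Real.log_pow,
      Real.log_div (by positivity) hq0.ne', Real.log_rpow hx0]
    -- `iq log 2 ≤ log q < (iq + 1) log 2`
    have hlq_lo : (iq q : ℝ) * Real.log 2 ≤ Real.log q := by
      rw [← Real.log_pow]; exact Real.log_le_log (by positivity) hlo
    have hlq_hi : Real.log q < ((iq q : ℝ) + 1) * Real.log 2 := by
      have := Real.log_lt_log hq0 hhi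
      rw [Real.log_mul (by norm_num) (by positivity), Real.log_pow] at this
      linarith
    have hl2 : 0 < Real.log 2 := Real.log_pos (by norm_num)
    have hlogq : Real.log q < (1 - ε) * L := by
      rw [← Real.log_rpow hx0]; exact Real.log_lt_log hq0 hqx
    have hε'L_eq : ε' * L = ε * L / 1000 := by rw [hε']; ring
    have hεL_lt : ε * L < L := mul_lt_of_lt_one_left hL0 hε1
    have hεL0 : 0 < ε * L := mul_pos hε hL0
    push_cast
    rw [← hL]
    refine ⟨by linarith, by linarith, by linarith⟩
  -- (d6) the class index is at most `⌊log₂ x⌋`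
  have hd6 : ∀ q ∈ Q, iq q ≤ ⌊Real.logb 2 x⌋₊ := by
    intro q hq
    obtain ⟨-, hqx, -⟩ := hQmem q hq
    exact le_floor_logb_of_pow_le hx0 ((hd1 q hq).1.trans (hqx.le.trans hxε.le))
  -- the remainder attached to `q` and the per-`q` inequality
  set RR : ℕ → ℕ → ℕ → ℝ := fun i l q =>
    ∑ m ∈ Finset.Ico 1 ⌈Mi x i⌉₊, ∑ n ∈ Finset.Ico 1 ⌈Nx x⌉₊,
      (if m * n ∣ primesProdBelow Z then al x i l m * bl x i l n * remG a b c x (q * (m * n)) else 0)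
    with hRR
  set Rq : ℕ → ℝ := fun q => ∑ l ∈ Finset.range (Lc x (iq q)), RR (iq q) l q with hRq
  set C' : ℝ := Cf + c₀ * C₄ with hC'
  have hC'0 : 0 ≤ C' := by positivity
  -- `q` is *active* when Lemma 2 applies at the level `Z`, i.e. `Z ≤ (MN)^{1/2}`
  have hkey : ∀ q ∈ Q,
      cq q * ((rhoG a b c q : ℝ) * x / q) * (Λz / Real.log Z) *
          (f (Real.log (x ^ (16 / 15 : ℝ) / q) / Real.log Z) - C' * ε) -
        (if 0 < rhoG a b c q ∧ Z ≤ (Mi x (iq q) * Nx x) ^ (1 / 2 : ℝ) then cq q * Rq q else 0) ≤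
      cq q * (siftedCountG a b c x q Z : ℝ) := by
    intro q hq
    obtain ⟨hq1, hqx, hcop⟩ := hQmem q hq
    have hc0 : 0 ≤ cq q := (hcq q).1
    rcases Nat.eq_zero_or_pos (rhoG a b c q) with hρ | hρ
    · rw [siftedCountG_eq_zero_of_rhoG_eq_zero ha.ne' hirr x hρ, if_neg (by omega), hρ]
      simp
    obtain ⟨hMN0, hMNlo, hMNhi, hMN16⟩ := hd4 q hq
    have hq0' : (0 : ℝ) < q := by exact_mod_cast hq1
    have hX0 : 0 ≤ (rhoG a b c q : ℝ) * x / q := by positivity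
    have hS0 : (0 : ℝ) ≤ cq q * (siftedCountG a b c x q Z : ℝ) := by positivity
    by_cases hact : Z ≤ (Mi x (iq q) * Nx x) ^ (1 / 2 : ℝ)
    · -- Lemma 2, lower bound, at the level `Z`
      rw [if_pos ⟨hρ, hact⟩]
      have H := (Hq x (iq q) x q hx0 (by omega) hρ Z hZ2 hact hcop).2
      dsimp only at H
      -- main term and `E`
      have hmain := main_term_lower_gen hVpos hΛ0pos hFf hγ hγ2 hLip hfmax hε hε1.le hε'0.le
        hε'ε hx1 hZ ⟨hq1, hqx⟩ hMN0 hact ⟨hMNlo, hMNhi⟩ hΛZ hΛz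
      have hu : Z = min Z ((Mi x (iq q) * Nx x) ^ (1 / 2 : ℝ)) := (min_eq_left hact).symm
      have hVle := densityProd_level_le_gen hΛ0pos hγ hε hε1.le hε'0.le hε'ε hx1 hZ ⟨hq1, hqx⟩
        ⟨le_rfl, hZ.1⟩ hMN0 hMNlo hu hΛZ hΛz
      have hEle : c₀ * (ε₂ + ε₂⁻¹ ^ 8 * Real.exp (K + L₂) *
          Real.log (Mi x (iq q) * Nx x) ^ (-(1 / 3 : ℝ))) ≤ c₀ * ε := by
        refine mul_le_mul_of_nonneg_left ?_ hc₀.le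
        have := hE _ hMN0 hMN16
        rw [hε₂]; linarith
      have hV0 : 0 ≤ densityProdG a b c Z := (hVpos _).le
      -- combine: the target main term is below Lemma 2's main term
      have hcomb : ((rhoG a b c q : ℝ) * x / q) * (Λz / Real.log Z) *
          (f (Real.log (x ^ (16 / 15 : ℝ) / q) / Real.log Z) - C' * ε) ≤
          densityProdG a b c Z * ((rhoG a b c q : ℝ) * x / q) *
            (f (Real.log (Mi x (iq q) * Nx x) / Real.log Z) -
              c₀ * (ε₂ + ε₂⁻¹ ^ 8 * Real.exp (K + L₂) *
                Real.log (Mi x (iq q) * Nx x) ^ (-(1 / 3 : ℝ)))) := by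
        have h1 : Λz / Real.log Z * (f (Real.log (x ^ (16 / 15 : ℝ) / q) / Real.log Z) - Cf * ε) -
            Λz / Real.log Z * C₄ * (c₀ * ε) ≤
            densityProdG a b c Z * f (Real.log (Mi x (iq q) * Nx x) / Real.log Z) -
              densityProdG a b c Z * (c₀ * ε) :=
          sub_le_sub hmain (mul_le_mul_of_nonneg_right hVle (by positivity))
        have h2 : densityProdG a b c Z * f (Real.log (Mi x (iq q) * Nx x) / Real.log Z) -
              densityProdG a b c Z * (c₀ * ε) ≤
            densityProdG a b c Z * (f (Real.log (Mi x (iq q) * Nx x) / Real.log Z) -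
              c₀ * (ε₂ + ε₂⁻¹ ^ 8 * Real.exp (K + L₂) *
                Real.log (Mi x (iq q) * Nx x) ^ (-(1 / 3 : ℝ)))) := by
          rw [mul_sub]; exact sub_le_sub le_rfl (mul_le_mul_of_nonneg_left hEle hV0)
        have h3 := mul_le_mul_of_nonneg_left (h1.trans h2) hX0
        have e : (rhoG a b c q : ℝ) * x / q * (Λz / Real.log Z *
            (f (Real.log (x ^ (16 / 15 : ℝ) / q) / Real.log Z) - Cf * ε) -
              Λz / Real.log Z * C₄ * (c₀ * ε)) =
            (rhoG a b c q : ℝ) * x / q * (Λz / Real.log Z) *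
              (f (Real.log (x ^ (16 / 15 : ℝ) / q) / Real.log Z) - C' * ε) := by
          rw [hC']; ring
        calc _ = _ := e.symm
          _ ≤ _ := h3
          _ = _ := by ring
      calc cq q * ((rhoG a b c q : ℝ) * x / q) * (Λz / Real.log Z) *
              (f (Real.log (x ^ (16 / 15 : ℝ) / q) / Real.log Z) - C' * ε) - cq q * Rq q
          = cq q * (((rhoG a b c q : ℝ) * x / q) * (Λz / Real.log Z) *
              (f (Real.log (x ^ (16 / 15 : ℝ) / q) / Real.log Z) - C' * ε)) - cq q * Rq q := by
            ring
        _ ≤ cq q * (densityProdG a b c Z * ((rhoG a b c q : ℝ) * x / q) *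
            (f (Real.log (Mi x (iq q) * Nx x) / Real.log Z) -
              c₀ * (ε₂ + ε₂⁻¹ ^ 8 * Real.exp (K + L₂) *
                Real.log (Mi x (iq q) * Nx x) ^ (-(1 / 3 : ℝ))))) - cq q * Rq q :=
            sub_le_sub_right (mul_le_mul_of_nonneg_left hcomb hc0) _
        _ = cq q * (densityProdG a b c Z * ((rhoG a b c q : ℝ) * x / q) *
            (f (Real.log (Mi x (iq q) * Nx x) / Real.log Z) -
              c₀ * (ε₂ + ε₂⁻¹ ^ 8 * Real.exp (K + L₂) *
                Real.log (Mi x (iq q) * Nx x) ^ (-(1 / 3 : ℝ)))) - Rq q) := by ring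
        _ ≤ cq q * (siftedCountG a b c x q Z : ℝ) := mul_le_mul_of_nonneg_left H hc0
    · -- `Z > (MN)^{1/2}`: the main term is nonpositive
      rw [if_neg (fun h => hact h.2), sub_zero]
      have hlt : (Mi x (iq q) * Nx x) ^ (1 / 2 : ℝ) < Z := lt_of_not_ge hact
      have htriv := main_term_lower_trivial_gen hVpos hFf hγ hγ2 hLip hfmax hε hε1.le hε'0.le
        hε'ε hx1 hZ ⟨hq1, hqx⟩ hMN0 hlt hMNlo
      have hle : Λz / Real.log Z * (f (Real.log (x ^ (16 / 15 : ℝ) / q) / Real.log Z) - C' * ε) ≤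
          Λz / Real.log Z * (f (Real.log (x ^ (16 / 15 : ℝ) / q) / Real.log Z) - Cf * ε) := by
        refine mul_le_mul_of_nonneg_left (sub_le_sub_left ?_ _) hΛzZ0
        refine mul_le_mul_of_nonneg_right ?_ hε.le
        rw [hC']; linarith [mul_nonneg hc₀.le hC₄0.le]
      have hneg : Λz / Real.log Z *
          (f (Real.log (x ^ (16 / 15 : ℝ) / q) / Real.log Z) - C' * ε) ≤ 0 := hle.trans htriv
      calc cq q * ((rhoG a b c q : ℝ) * x / q) * (Λz / Real.log Z) *
              (f (Real.log (x ^ (16 / 15 : ℝ) / q) / Real.log Z) - C' * ε)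
          = cq q * ((rhoG a b c q : ℝ) * x / q) * (Λz / Real.log Z *
              (f (Real.log (x ^ (16 / 15 : ℝ) / q) / Real.log Z) - C' * ε)) := by ring
        _ ≤ 0 := mul_nonpos_of_nonneg_of_nonpos (mul_nonneg hc0 hX0) hneg
        _ ≤ cq q * (siftedCountG a b c x q Z : ℝ) := hS0
  -- sum the main terms
  have hmainsum : ∑ q ∈ Q, cq q * ((rhoG a b c q : ℝ) * x / q) * (Λz / Real.log Z) *
      (f (Real.log (x ^ (16 / 15 : ℝ) / q) / Real.log Z) - C' * ε) =
      densityProdG a b c z * x * ∑ q ∈ Q, cq q * (rhoG a b c q : ℝ) / q *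
        f (Real.log (x ^ (16 / 15 : ℝ) / q) / Real.log Z) * (Real.log z / Real.log Z) -
      densityProdG a b c z * x * (C' * ε) *
        ∑ q ∈ Q, cq q * (rhoG a b c q : ℝ) / q * (Real.log z / Real.log Z) := by
    rw [Finset.mul_sum, Finset.mul_sum, ← Finset.sum_sub_distrib]
    refine Finset.sum_congr rfl fun q hq => ?_
    rw [hVz]
    have hlz0 : Real.log z ≠ 0 := by rw [hlz]; positivity
    have hlZ0' : Real.log Z ≠ 0 := hlZ0.ne'
    have hq0 : (q : ℝ) ≠ 0 := by have := (hQmem q hq).1; positivity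
    field_simp
    try ring
  -- the density sum is `O_γ(1)`
  have hdens : ∑ q ∈ Q, cq q * (rhoG a b c q : ℝ) / q * (Real.log z / Real.log Z) ≤ Rγ := by
    have h1 : ∀ q ∈ Q, cq q * (rhoG a b c q : ℝ) / q * (Real.log z / Real.log Z) ≤
        (rhoG a b c q : ℝ) / q := by
      intro q _
      have hlzZ : Real.log z ≤ Real.log Z := Real.log_le_log hz0 hZ.1
      have hlz0 : 0 < Real.log z := by rw [hlz]; positivity
      have hratio : Real.log z / Real.log Z ≤ 1 := (div_le_one (by linarith)).mpr hlzZ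
      have hρq : 0 ≤ (rhoG a b c q : ℝ) / q := by positivity
      have hr0 : 0 ≤ Real.log z / Real.log Z := div_nonneg hlz0.le (by linarith)
      calc cq q * (rhoG a b c q : ℝ) / q * (Real.log z / Real.log Z)
          = cq q * (Real.log z / Real.log Z) * ((rhoG a b c q : ℝ) / q) := by ring
        _ ≤ 1 * 1 * ((rhoG a b c q : ℝ) / q) := by
            refine mul_le_mul_of_nonneg_right ?_ hρq
            exact mul_le_mul (hcq q).2 hratio hr0 zero_le_one
        _ = (rhoG a b c q : ℝ) / q := by ring
    refine (Finset.sum_le_sum h1).trans (hR Q fun q hq => ?_)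
    obtain ⟨hq1, hqx, hcop⟩ := hQmem q hq
    exact ⟨hq1, hqx.trans hxε,
      Nat.Coprime.coprime_dvd_right (primesProdBelow_dvd_of_le hZ.1) hcop⟩
  -- the remainder sum is `≤ ε V(z) x`
  have hremsum : ∑ q ∈ Q, (if 0 < rhoG a b c q ∧ Z ≤ (Mi x (iq q) * Nx x) ^ (1 / 2 : ℝ)
      then cq q * Rq q else 0) ≤ ε * (densityProdG a b c z * x) := by
    rw [← Finset.sum_filter]
    set Q' := Q.filter fun q => 0 < rhoG a b c q ∧ Z ≤ (Mi x (iq q) * Nx x) ^ (1 / 2 : ℝ)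
      with hQ'
    have hQ'sub : Q' ⊆ Q := Finset.filter_subset _ _
    set Kset := Q'.image iq with hKset
    rw [← Finset.sum_fiberwise_of_maps_to (s := Q') (t := Kset) (g := iq)
      (fun q hq => Finset.mem_image_of_mem iq hq)]
    -- each class contributes at most `Lmax C₁ x^{1−ε'}`
    have hclass : ∀ k ∈ Kset, ∑ q ∈ Q'.filter (fun q => iq q = k), cq q * Rq q ≤
        Lmax * C₁ * x ^ (1 - ε') := by
      intro k _
      set T := Q'.filter (fun q => iq q = k) with hT
      have hTmem : ∀ q ∈ T, q ∈ Q ∧ iq q = k := by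
        intro q hq
        rw [hT, Finset.mem_filter, hQ', Finset.mem_filter] at hq
        exact ⟨hq.1.1, hq.2⟩
      -- rewrite `Rq q` on the fiber through `k`
      have hRq_eq : ∀ q ∈ T, Rq q = ∑ l ∈ Finset.range (Lc x k), RR k l q := by
        intro q hq
        obtain ⟨-, hi⟩ := hTmem q hq
        simp only [hRq, hi]
      rw [show ∑ q ∈ T, cq q * Rq q = ∑ q ∈ T, cq q * ∑ l ∈ Finset.range (Lc x k), RR k l q
        from Finset.sum_congr rfl fun q hq => by rw [hRq_eq q hq]]
      -- swap `q` and `l`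
      rw [show ∑ q ∈ T, cq q * ∑ l ∈ Finset.range (Lc x k), RR k l q =
          ∑ l ∈ Finset.range (Lc x k), ∑ q ∈ T, cq q * RR k l q by
        rw [Finset.sum_comm]; exact Finset.sum_congr rfl fun q _ => Finset.mul_sum _ _ _]
      -- each `l` contributes at most `C₁ x^{1−ε'}`
      have hl : ∀ l ∈ Finset.range (Lc x k), ∑ q ∈ T, cq q * RR k l q ≤ C₁ * x ^ (1 - ε') := by
        intro l _
        have hT' : ∀ q ∈ T, 0 < q ∧ q.Coprime (primesProdBelow Z) ∧ (q : ℝ) * Mi x k ≤ D := by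
          intro q hq
          obtain ⟨hqQ, hi⟩ := hTmem q hq
          have h2' := (hd2 q hqQ).2
          rw [hi] at h2'
          exact ⟨(hQmem q hqQ).1, (hQmem q hqQ).2.2, h2'⟩
        have habs := abs_remainder_class_leG (a := a) (b := b) (c := c) x Z (Mi x k) (Nx x) D T
          cq (al x k l) (bl x k l) hT' (fun q => abs_le.mpr ⟨by linarith [(hcq q).1], (hcq q).2⟩)
          (hal x k l)
        obtain ⟨hb1, hb2⟩ := indicator_coeff_admissible Z (hbl x k l)
        have hcor := hC₁ x _ hx2 hb1 hb2
        rw [← hN, ← hNx_eq] at hcor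
        exact (le_abs_self _).trans (habs.trans hcor)
      calc ∑ l ∈ Finset.range (Lc x k), ∑ q ∈ T, cq q * RR k l q
          ≤ ∑ l ∈ Finset.range (Lc x k), C₁ * x ^ (1 - ε') := Finset.sum_le_sum hl
        _ = (Lc x k : ℝ) * (C₁ * x ^ (1 - ε')) := by
            rw [Finset.sum_const, Finset.card_range, nsmul_eq_mul]
        _ ≤ Lmax * (C₁ * x ^ (1 - ε')) := mul_le_mul_of_nonneg_right (hLc x k) (by positivity)
        _ = Lmax * C₁ * x ^ (1 - ε') := by ring
    -- number of classes
    have hKcard : (Kset.card : ℝ) ≤ ((⌊Real.logb 2 x⌋₊ : ℝ) + 1) ^ 2 := by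
      have hsub : Kset ⊆ Finset.range (⌊Real.logb 2 x⌋₊ + 1) := by
        intro k hk
        obtain ⟨q, hq, rfl⟩ := Finset.mem_image.mp hk
        rw [Finset.mem_range]
        exact Nat.lt_succ_of_le (hd6 q (hQ'sub hq))
      have := Finset.card_le_card hsub
      rw [Finset.card_range] at this
      have h' : (Kset.card : ℝ) ≤ ((⌊Real.logb 2 x⌋₊ + 1 : ℕ) : ℝ) := by exact_mod_cast this
      push_cast at h'
      have h1 : (1 : ℝ) ≤ (⌊Real.logb 2 x⌋₊ : ℝ) + 1 := by
        have : (0 : ℝ) ≤ (⌊Real.logb 2 x⌋₊ : ℝ) := Nat.cast_nonneg _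
        linarith
      calc (Kset.card : ℝ) ≤ (⌊Real.logb 2 x⌋₊ : ℝ) + 1 := h'
        _ = ((⌊Real.logb 2 x⌋₊ : ℝ) + 1) * 1 := by ring
        _ ≤ ((⌊Real.logb 2 x⌋₊ : ℝ) + 1) * ((⌊Real.logb 2 x⌋₊ : ℝ) + 1) :=
            mul_le_mul_of_nonneg_left h1 (by linarith)
        _ = ((⌊Real.logb 2 x⌋₊ : ℝ) + 1) ^ 2 := by ring
    calc ∑ k ∈ Kset, ∑ q ∈ Q'.filter (fun q => iq q = k), cq q * Rq q
        ≤ ∑ k ∈ Kset, Lmax * C₁ * x ^ (1 - ε') := Finset.sum_le_sum hclass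
      _ = (Kset.card : ℝ) * (Lmax * C₁ * x ^ (1 - ε')) := by rw [Finset.sum_const, nsmul_eq_mul]
      _ ≤ ((⌊Real.logb 2 x⌋₊ : ℝ) + 1) ^ 2 * (Lmax * C₁ * x ^ (1 - ε')) :=
          mul_le_mul_of_nonneg_right hKcard (by positivity)
      _ = ((⌊Real.logb 2 x⌋₊ : ℝ) + 1) ^ 2 * (Lmax * C₁) * x ^ (1 - ε') := by ring
      _ ≤ (ε * (7 / 8 * lambda0G a b c) / γ) * x / Real.log x := hrem
      _ ≤ ε * (densityProdG a b c z * x) := by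
          rw [hVz, hlz, div_le_iff₀ hL0]
          have : ε * (7 / 8 * lambda0G a b c) / γ * x =
              ε * ((7 / 8 * lambda0G a b c) / (γ * L) * x) * L := by
            field_simp
          rw [this]
          refine mul_le_mul_of_nonneg_right (mul_le_mul_of_nonneg_left ?_ hε.le) hL0.le
          exact mul_le_mul_of_nonneg_right (div_le_div_of_nonneg_right hΛz_lo (by positivity))
            hx0.le
  -- conclusion
  have htotal := Finset.sum_le_sum hkey
  rw [Finset.sum_sub_distrib, hmainsum] at htotal
  have hVx : 0 ≤ densityProdG a b c z * x := mul_nonneg (hVpos _).le hx0.le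
  have hA : densityProdG a b c z * x * (C' * ε) *
      ∑ q ∈ Q, cq q * (rhoG a b c q : ℝ) / q * (Real.log z / Real.log Z) ≤
      densityProdG a b c z * x * (C' * ε) * Rγ :=
    mul_le_mul_of_nonneg_left hdens (mul_nonneg hVx (mul_nonneg hC'0 hε.le))
  calc densityProdG a b c z * x * (∑ q ∈ Q, cq q * (rhoG a b c q : ℝ) / q *
          f (Real.log (x ^ (16 / 15 : ℝ) / q) / Real.log Z) * (Real.log z / Real.log Z) -
        ((Cf + c₀ * C₄) * Rγ + 1) * ε)
      = densityProdG a b c z * x * ∑ q ∈ Q, cq q * (rhoG a b c q : ℝ) / q *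
          f (Real.log (x ^ (16 / 15 : ℝ) / q) / Real.log Z) * (Real.log z / Real.log Z) -
        densityProdG a b c z * x * (C' * ε) * Rγ - ε * (densityProdG a b c z * x) := by
          rw [hC']; ring
    _ ≤ densityProdG a b c z * x * ∑ q ∈ Q, cq q * (rhoG a b c q : ℝ) / q *
          f (Real.log (x ^ (16 / 15 : ℝ) / q) / Real.log Z) * (Real.log z / Real.log Z) -
        densityProdG a b c z * x * (C' * ε) *
          ∑ q ∈ Q, cq q * (rhoG a b c q : ℝ) / q * (Real.log z / Real.log Z) -
        ∑ q ∈ Q, (if 0 < rhoG a b c q ∧ Z ≤ (Mi x (iq q) * Nx x) ^ (1 / 2 : ℝ)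
          then cq q * Rq q else 0) := by linarith [hA, hremsum]
    _ ≤ ∑ q ∈ Q, cq q * (siftedCountG a b c x q Z : ℝ) := htotal

/-! ### Assembly: Iwaniec's Theorem for a general `G` from the level of distribution of `𝒜_G` -/

/-- **Both halves of Proposition 2 for `𝒜_G` from Lemma 2 and the level of distribution of
`𝒜_G` — PROVED** (`proposition2G_upper_of`, `proposition2G_lower_const_of`).
[cite: IwaniecInventiones1978, Proposition 2] -/
theorem proposition2G_of_lemma2_of_prop1G (ha : 0 < a) (hc : Odd c)
    (hirr : Irreducible (quadPoly a b c)) (h2 : lemma2_bilinearSieve)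
    (h1c : proposition1G_corollary a b c) :
    proposition2G_upper a b c ∧ proposition2G_lower_const a b c :=
  ⟨proposition2G_upper_of ha hc hirr h2 h1c, proposition2G_lower_const_of ha hc hirr h2 h1c⟩

/-- **Iwaniec's Theorem for every `G` from Lemma 2 and the level of distribution of the `𝒜_G` —
PROVED:** `lemma2_bilinearSieve → (∀ G as in the Theorem, proposition1G_corollary G) →
theorem_quadratic` (Proposition 2 for `𝒜_G` by the two theorems above, then §6 for general `G`,
`theorem_quadratic_of_prop2G`). [cite: IwaniecInventiones1978, Theorem p. 172] -/
theorem theorem_quadratic_of_lemma2_of_prop1G (h2 : lemma2_bilinearSieve)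
    (h1 : ∀ a b c : ℤ, 0 < a → Odd c → Irreducible (quadPoly a b c) →
      proposition1G_corollary a b c) :
    theorem_quadratic :=
  theorem_quadratic_of_prop2G fun a b c ha hc hirr =>
    proposition2G_of_lemma2_of_prop1G ha hc hirr h2 (h1 a b c ha hc hirr)

/-- **Iwaniec's Theorem (p. 172) for every irreducible `G = aX² + bX + c` (`a > 0`, `c` odd) from
the level of distribution `x^{16/15}` of the sequences `𝒜_G` alone — PROVED**, Iwaniec's linear
sieve with the bilinear form of the remainder term being proved in the tree
(`lemma2_bilinearSieve_holds`, Acta Arith. 37 (1980), Theorem 1):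
`(∀ G as in the Theorem, proposition1G_corollary G) → theorem_quadratic`.  The hypothesis is
Iwaniec's Corollary of Proposition 1 (p. 176) for a general `G` — the one step of the paper printed
only for `n² + 1` ("the general case being similar"); for `G = X² + 1` it is the tree's
`proposition1_corollary_holds` (`proposition1G_corollary_one_zero_one_iff`).
[cite: IwaniecInventiones1978, Theorem p. 172 and Corollary p. 176] -/
theorem theorem_quadratic_of_prop1G
    (h1 : ∀ a b c : ℤ, 0 < a → Odd c → Irreducible (quadPoly a b c) →
      proposition1G_corollary a b c) :
    theorem_quadratic :=
  theorem_quadratic_of_lemma2_of_prop1G lemma2_bilinearSieve_holds h1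

/-- The qualitative half for a single `G`: `Ω(|G(n)|) ≤ 2` for infinitely many `n`, from the level
of distribution of `𝒜_G` alone (Lemke Oliver's Theorem 1 for this `G`, given his Lemma 3 at the
level `x^{16/15}`). [cite: LemkeOliverActaArith2012, Theorem 1] -/
theorem infinite_setOf_isAtMostAlmostPrime_of_prop1G (ha : 0 < a) (hc : Odd c)
    (hirr : Irreducible (quadPoly a b c)) (h1c : proposition1G_corollary a b c) :
    {n : ℕ | Nat.IsAtMostAlmostPrime 2 (a * (n : ℤ) ^ 2 + b * n + c).natAbs}.Infinite :=
  infinite_setOf_isAtMostAlmostPrime_of_prop2G ha hc hirr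
    (proposition2G_upper_of ha hc hirr lemma2_bilinearSieve_holds h1c)
    (proposition2G_lower_const_of ha hc hirr lemma2_bilinearSieve_holds h1c)

/-- Consistency at `G = X² + 1`: the hypothesis of `theorem_quadratic_of_prop1G` holds for
`(a, b, c) = (1, 0, 1)` — it is the tree's PROVED Corollary of Proposition 1
(`proposition1_corollary_holds` fed through `proposition1G_corollary_one_zero_one_iff`).
[cite: IwaniecInventiones1978, Corollary p. 176] -/
theorem proposition1G_corollary_one_zero_one : proposition1G_corollary 1 0 1 :=
  proposition1G_corollary_one_zero_one_iff.mpr proposition1_corollary_holds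

/-! ### Display (1) and the Theorem for a single `G` from its level of distribution -/

open scoped Classical in
/-- **Display (1) for a single `G` from a weighted-sum lower bound with a constant `> 1/77` —
PROVED** (the quantitative half of `theorem_quadratic_of_weightedSumG_lower`, localised to one
`G`): if `W(𝒜_G, x^{1/5}) ≥ C Γ_G x/log x` for large `x` with some `C > 1/77`, then
`#{1 ≤ n ≤ x : Ω(|G(n)|) ≤ 2} > (Γ_G/77) x/log x` for large `x` (`weightedSumG_le_card` and
`log x = o(x^{1/10})`). [cite: IwaniecInventiones1978, §2 p. 173 (2) and Theorem p. 172 (1)] -/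
theorem card_P2G_lower_of_weightedSumG_lower (ha : 0 < a) (hc : Odd c)
    (hirr : Irreducible (quadPoly a b c))
    (h : ∃ C : ℝ, 1 / 77 < C ∧ ∀ᶠ x : ℝ in atTop,
      C * gammaG a b c * x / Real.log x ≤ weightedSumG a b c x (x ^ (1 / 5 : ℝ))) :
    ∀ᶠ x : ℝ in atTop, gammaG a b c / 77 * x / Real.log x <
      (((Finset.Icc 1 ⌊x⌋₊).filter fun n : ℕ =>
        Nat.IsAtMostAlmostPrime 2 (gAbs a b c n)).card : ℝ) := by
  obtain ⟨C₀, hC₀, hW⟩ := h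
  have hΓ : 0 < gammaG a b c := gammaG_pos ha hc hirr
  set Γ := gammaG a b c with hΓdef
  set Kr : ℝ := (sizeK a b c : ℝ) with hKr
  have hK1 : 1 ≤ Kr := one_le_sizeK ha
  set δ : ℝ := (C₀ - 1 / 77) * Γ / (5 + 2 * Kr) with hδ
  have hδ0 : 0 < δ := by
    have : 0 < C₀ - 1 / 77 := by linarith
    positivity
  have hlog : ∀ᶠ x : ℝ in atTop, ‖Real.log x‖ ≤ δ * ‖x ^ (1 / 10 : ℝ)‖ :=
    (Asymptotics.isLittleO_iff.mp
      (isLittleO_log_rpow_atTop (by norm_num : (0 : ℝ) < 1 / 10))) hδ0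
  set x₀ : ℝ := ((a + |b ^ 2 - 4 * a * c| + 2 : ℤ) : ℝ) ^ (5 : ℕ) with hx₀
  filter_upwards [hW, hlog, eventually_ge_atTop x₀, eventually_ge_atTop (32 : ℝ)] with
    x hWx hlogx hxx₀ hx32
  have hx1 : 1 < x := by linarith
  have hx0 : 0 < x := by linarith
  set u : ℝ := x ^ (1 / 10 : ℝ) with hu
  have hu1 : 1 ≤ u := Real.one_le_rpow hx1.le (by norm_num)
  have hu0 : 0 < u := by linarith
  have hz2 : x ^ (1 / 5 : ℝ) = u ^ 2 := by
    rw [hu, ← Real.rpow_mul_natCast hx0.le]; norm_num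
  have hsqrt : Real.sqrt (x ^ (1 / 5 : ℝ)) = u := by
    rw [hz2, Real.sqrt_sq hu0.le]
  set T : ℝ := ((a + |b ^ 2 - 4 * a * c| + 2 : ℤ) : ℝ) with hT
  have hT2 : 2 ≤ T := by
    have : (2 : ℤ) ≤ a + |b ^ 2 - 4 * a * c| + 2 := by
      have := abs_nonneg (b ^ 2 - 4 * a * c); omega
    rw [hT]; exact_mod_cast this
  have hTz : T ≤ x ^ (1 / 5 : ℝ) := by
    have h5 : T ^ (5 : ℕ) ≤ x := hxx₀
    have hT0 : 0 ≤ T := by linarith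
    calc T = (T ^ (5 : ℕ)) ^ (1 / 5 : ℝ) := by
          rw [← Real.rpow_natCast, ← Real.rpow_mul hT0]; norm_num
      _ ≤ x ^ (1 / 5 : ℝ) := Real.rpow_le_rpow (by positivity) h5 (by norm_num)
  have h2z : (2 : ℝ) ≤ x ^ (1 / 5 : ℝ) := hT2.trans hTz
  have hza : (a : ℝ) < x ^ (1 / 5 : ℝ) := by
    have : (a : ℝ) < T := by
      rw [hT]; push_cast
      have := abs_nonneg ((b : ℝ) ^ 2 - 4 * a * c)
      linarith
    exact this.trans_le hTz
  have hzd : ((|b ^ 2 - 4 * a * c| : ℤ) : ℝ) < x ^ (1 / 5 : ℝ) := by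
    have : ((|b ^ 2 - 4 * a * c| : ℤ) : ℝ) < T := by
      rw [hT]; push_cast
      have : (0 : ℝ) < a := by exact_mod_cast ha
      linarith
    exact this.trans_le hTz
  have hWle := weightedSumG_le_card ha hirr hx1 h2z hza hzd
  rw [hsqrt] at hWle
  have hL0 : 0 < Real.log x := Real.log_pos hx1
  have hLu : Real.log x ≤ δ * u := by
    rw [Real.norm_eq_abs, Real.norm_eq_abs, abs_of_nonneg hL0.le,
      abs_of_nonneg (Real.rpow_nonneg hx0.le _)] at hlogx
    exact hlogx
  have hkey : (4 + 2 * Kr) * x / u < (C₀ - 1 / 77) * Γ * x / Real.log x := by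
    have h45 : (4 + 2 * Kr) * x / u < (5 + 2 * Kr) * x / u := by
      gcongr; norm_num
    refine h45.trans_le ?_
    rw [div_le_div_iff₀ hu0 hL0]
    calc (5 + 2 * Kr) * x * Real.log x ≤ (5 + 2 * Kr) * x * (δ * u) := by gcongr
      _ = (C₀ - 1 / 77) * Γ * x * u := by rw [hδ]; field_simp
  have e1 : C₀ * Γ * x / Real.log x =
      Γ / 77 * x / Real.log x + (C₀ - 1 / 77) * Γ * x / Real.log x := by ring
  linarith [hWx, hWle, hkey, e1]

open scoped Classical in
/-- **Display (1) for a single `G` from its level of distribution — PROVED:**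
`proposition1G_corollary G ⟹ #{1 ≤ n ≤ x : Ω(|G(n)|) ≤ 2} > (Γ_G/77) x/log x` for all large `x`
(Lemma 2 by `lemma2_bilinearSieve_holds`). [cite: IwaniecInventiones1978, Theorem p. 172 (1)] -/
theorem card_P2G_lower_of_prop1G (ha : 0 < a) (hc : Odd c) (hirr : Irreducible (quadPoly a b c))
    (h1c : proposition1G_corollary a b c) :
    ∀ᶠ x : ℝ in atTop, gammaG a b c / 77 * x / Real.log x <
      (((Finset.Icc 1 ⌊x⌋₊).filter fun n : ℕ =>
        Nat.IsAtMostAlmostPrime 2 (gAbs a b c n)).card : ℝ) :=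
  card_P2G_lower_of_weightedSumG_lower ha hc hirr
    (weightedSumG_lower_of_prop2G ha hc hirr
      (proposition2G_upper_of ha hc hirr lemma2_bilinearSieve_holds h1c)
      (proposition2G_lower_const_of ha hc hirr lemma2_bilinearSieve_holds h1c))

open scoped Classical in
/-- **Iwaniec's Theorem for a single `G` from the level of distribution of `𝒜_G` — PROVED**: the
`G`-instance of `theorem_quadratic` (both clauses: `Ω(|G(n)|) ≤ 2` infinitely often, and display
(1) with the constant `1/77`) follows from `proposition1G_corollary G` for THIS `G` alone.
[cite: IwaniecInventiones1978, Theorem p. 172] -/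
theorem theorem_quadratic_single_of_prop1G (ha : 0 < a) (hc : Odd c)
    (hirr : Irreducible (quadPoly a b c)) (h1c : proposition1G_corollary a b c) :
    {n : ℕ | Nat.IsAtMostAlmostPrime 2 (a * (n : ℤ) ^ 2 + b * n + c).natAbs}.Infinite ∧
      ∀ᶠ x : ℝ in atTop, batemanHornConst ![quadPoly a b c] / 2 / 77 * x / Real.log x <
        (((Finset.Icc 1 ⌊x⌋₊).filter fun n : ℕ =>
          Nat.IsAtMostAlmostPrime 2 (a * (n : ℤ) ^ 2 + b * n + c).natAbs).card : ℝ) :=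
  ⟨infinite_setOf_isAtMostAlmostPrime_of_prop1G ha hc hirr h1c, card_P2G_lower_of_prop1G ha hc hirr h1c⟩

/-- **Proposition 2 for `𝒜_{X²+1}` in the general-`G` normalisation — PROVED unconditionally**
(the hypothesis by `proposition1G_corollary_one_zero_one`). [cite: IwaniecInventiones1978, Proposition 2] -/
theorem proposition2G_one_zero_one : proposition2G_upper 1 0 1 ∧ proposition2G_lower_const 1 0 1 :=
  proposition2G_of_lemma2_of_prop1G one_pos odd_one irreducible_quadPoly_one_zero_one
    lemma2_bilinearSieve_holds proposition1G_corollary_one_zero_one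

end Literature.NumberTheory.Sieve.Iwaniec1978

end
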